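import Summits.QuantumFields.YangMills.Theorems.UnitScaleTiltHistoryTailActionPartition
import Summits.QuantumFields.YangMills.Theorems.UnitScaleTiltHistoryTailClusters

/-!
# Route `UnitScaleTilt` — crux K2-L `HistoryTailL` (stmt-QuantumFields-19936), STUB 4c `stub_diluteExponent`: THE COMBINATORIAL CORE OF THE DILUTE-FAMILY
# EXPONENT BOUND — for an admissible history and a separated family `S` of top plaquettes, the localised small factors of the history's large-field
# plaquettes (clusters, multiplicity `μ₀ = 4d²`), the deep members' boxes and the budget inequalities `μ₀(σ_i + T_i) ≤ ¼(p_i² − p_j²)` give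
# `|S|·¼p_j² + Σ_i #P_i·σ_i + Zterm ≤ β·Σ_q T(q)` (support file; datum-free: the (α) rows enter as unfolded hypotheses at one pair `(h, W)`)

Fleet lead `ym-ust-18916-p1` (gen 3), 2026-08-27.  Inputs: `HistoryTailActionPartition.parts_le_total` (p491735), `HistoryTailClusters.members_le_max` (p490810),
`HistoryTailCornerBlocks.sum_sum_le_mul_sum_biUnion` / `card_filter_plaqCover_le` (p489892), `HistoryTailLaneTowerReach.tdist_add_le_pow_mul_sdist` (p489534).

* §1 `pow_mul_sdist_add_le` (CONTRACTION down `k` levels: `L^k·sdist_k + 2d ≤ tdist + 2d·L^k`, `L ≥ 2`), `fine_separation` (level-`j` separation `ccol·X` ⇒ fine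
  separation `L^j(ccol·X − 2d)`);
* §2 `cluster_lower_bound` — `β·Σ_{U_{i,Γ}} T ≥ max(1, n_Γ/μ₀)·¼p_i²` from the localised small factors and the multiplicity;
* §3 **`dilute_core`** — the accounting.

References: T. Bałaban, CMP 102 (1985) 255–275 [Balaban1985UV3] ((5) p.256, (41) p.266, (69)–(71) p.273).
-/

noncomputable section

open scoped BigOperators

namespace Summit.QuantumFields.YangMills.Theorems.HistoryTailDiluteCore

open Literature.MathematicalPhysics.QuantumFieldTheory.Balaban1983to89
open B10Eq38TorusDomains (toFine)
open Summit.QuantumFields.Balaban3D.Carriers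
open Summit.QuantumFields.Balaban3D.Proofs.CollarCount (tdist_blockOf_le)
open B3Taylor310LocalRemainder (tdist_comm tdist_triangle)
open Summit.QuantumFields.YangMills.Theorems (coarsen_toFine)
open Summit.QuantumFields.YangMills.Theorems.HistoryTailLaneTowerReach (tdist_add_le_pow_mul_sdist)
open Summit.QuantumFields.YangMills.Theorems.HistoryTailCornerBlocks (sum_sum_le_mul_sum_biUnion card_filter_plaqCover_le)
open Summit.QuantumFields.YangMills.Theorems.HistoryTailClusters (members_le_max)
open Summit.QuantumFields.YangMills.Theorems.HistoryTailActionPartition (parts_le_total)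
open Classical

variable {P : Params}

/-! ## §1 Contraction of the torus distance; fine separation of a separated family -/

/-- **CONTRACTION DOWN `k` LEVELS**: `L^k·sdist_k(x, y) + 2d ≤ tdist x y + 2d·L^k` for `L ≥ 2` (`CollarCount.tdist_blockOf_le` iterated; the rounding `+d` per
level is absorbed geometrically). [folklore] -/
theorem pow_mul_sdist_add_le (hL : 2 ≤ P.L) : ∀ (k : ℕ), k ≤ P.m + P.K → ∀ (x y : Site P 0),
    P.L ^ k * sdist k x y + 2 * P.d ≤ Site.tdist x y + 2 * P.d * P.L ^ k
  | 0, _, x, y => by simp [sdist, coarsen]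
  | k + 1, hk, x, y => by
    have ih := pow_mul_sdist_add_le hL k (by omega) x y
    have hstep : sdist (k + 1) x y ≤ sdist k x y / P.L + P.d := by
      unfold sdist
      rw [coarsen_succ, coarsen_succ]
      exact tdist_blockOf_le hk (coarsen k x) (coarsen k y)
    have h1 : P.L ^ (k + 1) * sdist (k + 1) x y ≤ P.L ^ k * sdist k x y + P.d * P.L ^ (k + 1) := by
      calc P.L ^ (k + 1) * sdist (k + 1) x y ≤ P.L ^ (k + 1) * (sdist k x y / P.L + P.d) := Nat.mul_le_mul_left _ hstep
        _ = P.L ^ k * (P.L * (sdist k x y / P.L)) + P.d * P.L ^ (k + 1) := by rw [pow_succ]; ring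
        _ ≤ P.L ^ k * sdist k x y + P.d * P.L ^ (k + 1) :=
            Nat.add_le_add_right (Nat.mul_le_mul_left _ (Nat.mul_div_le (sdist k x y) P.L)) _
    have h2 : 2 * P.d * P.L ^ k + P.d * P.L ^ (k + 1) ≤ 2 * P.d * P.L ^ (k + 1) := by
      have : 2 * P.L ^ k ≤ P.L ^ (k + 1) := by rw [pow_succ]; exact by nlinarith [pow_pos P.L_pos k]
      nlinarith
    omega

/-- **FINE SEPARATION OF A SEPARATED FAMILY**: level-`j` plaquettes with `ccol·X ≤ tdist(q.src, q′.src)` have representatives at fine distance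
`≥ L^j·(ccol·X − 2d)`. [cite: Balaban1985UV3, (71) p.273] -/
theorem fine_separation (hL : 2 ≤ P.L) {j : ℕ} (hj : j ≤ P.m + P.K) {q q' : Plaq P j} {ccol X : ℝ}
    (hsep : ccol * X ≤ (Site.tdist q.src q'.src : ℝ)) :
    (P.L : ℝ) ^ j * (ccol * X - 2 * P.d) ≤ (Site.tdist (toFine j q.src) (toFine j q'.src) : ℝ) := by
  have h1 := pow_mul_sdist_add_le hL j hj (toFine j q.src) (toFine j q'.src)
  have h2 : sdist j (toFine j q.src) (toFine j q'.src) = Site.tdist q.src q'.src := by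
    unfold sdist; rw [coarsen_toFine j hj, coarsen_toFine j hj]
  rw [h2] at h1
  have h3 : ((P.L ^ j * Site.tdist q.src q'.src + 2 * P.d : ℕ) : ℝ) ≤ ((Site.tdist (toFine j q.src) (toFine j q'.src) + 2 * P.d * P.L ^ j : ℕ) : ℝ) := by
    exact_mod_cast h1
  push_cast at h3
  have hLj : (0 : ℝ) ≤ (P.L : ℝ) ^ j := by positivity
  nlinarith [mul_le_mul_of_nonneg_left hsep hLj]

/-! ## §2 The per-cluster lower bound -/

/-- **A CLUSTER'S BLOCKS CARRY `max(1, n_Γ/μ₀)` SMALL FACTORS**: for `T ≥ 0`, `β ≥ 0`, localised small factors `¼p² ≤ β·Σ_{q ∈ Δ′(c)} T q` at every `c ∈ A`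
(the cluster's plaquettes, `A` non-empty) and corner blocks with base points in the covers:
`max(1, #A/(4d²))·¼p² ≤ β·Σ_{q ∈ ⋃_{c∈A} Δ′(c)} T q`. [cite: Balaban1985UV3, (70)-(71) p.273] -/
theorem cluster_lower_bound {i : ℕ} (Bl : Plaq P i → Finset (Plaq P 0)) (hBl : ∀ (c : Plaq P i) q, q ∈ Bl c → q.src ∈ plaqCover c)
    (T : Plaq P 0 → ℝ) (hT : ∀ q, 0 ≤ T q) {β p2 : ℝ} (hβ : 0 ≤ β) (A : Finset (Plaq P i)) (hA : A.Nonempty)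
    (hSF : ∀ c ∈ A, p2 ≤ β * ∑ q ∈ Bl c, T q) :
    max 1 ((A.card : ℝ) / (4 * (P.d * P.d) : ℕ)) * p2 ≤ β * ∑ q ∈ A.biUnion Bl, T q := by
  -- one block
  have hone : p2 ≤ β * ∑ q ∈ A.biUnion Bl, T q := by
    obtain ⟨c, hc⟩ := hA
    refine (hSF c hc).trans (mul_le_mul_of_nonneg_left ?_ hβ)
    exact Finset.sum_le_sum_of_subset_of_nonneg (Finset.subset_biUnion_of_mem Bl hc) fun q _ _ => hT q
  -- all blocks with multiplicity
  have hmult : ∑ c ∈ A, ∑ q ∈ Bl c, T q ≤ ((4 * (P.d * P.d) : ℕ) : ℝ) * ∑ q ∈ A.biUnion Bl, T q := by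
    refine sum_sum_le_mul_sum_biUnion A Bl T hT _ fun q _ => ?_
    refine le_trans (Finset.card_le_card fun c hc => ?_) (card_filter_plaqCover_le q.src A)
    rw [Finset.mem_filter] at hc ⊢
    exact ⟨hc.1, hBl c q hc.2⟩
  have hall : (A.card : ℝ) * p2 ≤ β * (((4 * (P.d * P.d) : ℕ) : ℝ) * ∑ q ∈ A.biUnion Bl, T q) := by
    calc (A.card : ℝ) * p2 = ∑ _c ∈ A, p2 := by rw [Finset.sum_const, nsmul_eq_mul]
      _ ≤ ∑ c ∈ A, β * ∑ q ∈ Bl c, T q := Finset.sum_le_sum hSF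
      _ = β * ∑ c ∈ A, ∑ q ∈ Bl c, T q := by rw [Finset.mul_sum]
      _ ≤ β * (((4 * (P.d * P.d) : ℕ) : ℝ) * ∑ q ∈ A.biUnion Bl, T q) := mul_le_mul_of_nonneg_left hmult hβ
  rcases le_or_gt ((A.card : ℝ) / (4 * (P.d * P.d) : ℕ)) 1 with hle | hlt
  · rw [max_eq_left hle, one_mul]; exact hone
  · rw [max_eq_right hlt.le]
    have hμ0 : (0 : ℝ) < ((4 * (P.d * P.d) : ℕ) : ℝ) := by
      have : (1 : ℝ) < (A.card : ℝ) / (4 * (P.d * P.d) : ℕ) := hlt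
      by_contra hle0
      push Not at hle0
      have : ((4 * (P.d * P.d) : ℕ) : ℝ) = 0 := le_antisymm hle0 (Nat.cast_nonneg _)
      rw [this, div_zero] at hlt
      linarith
    rw [div_mul_eq_mul_div, div_le_iff₀ hμ0]
    calc (A.card : ℝ) * p2 ≤ β * (((4 * (P.d * P.d) : ℕ) : ℝ) * ∑ q ∈ A.biUnion Bl, T q) := hall
      _ = β * (∑ q ∈ A.biUnion Bl, T q) * ((4 * (P.d * P.d) : ℕ) : ℝ) := by ring

/-! ## §3 The accounting -/

/-- **THE COMBINATORIAL CORE OF THE DILUTE-FAMILY EXPONENT BOUND.**  Data at ONE admissible pair: an admissible region history `r` of length `j` of the lane's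
regions (`M₁`, `Rcol`), non-negative plaquette terms `T` (the main action is `β·Σ_q T q`), corner blocks `Δ′(c) = Bl i c` with base points in the covers and
the localised small factors `¼p_i² ≤ β·Σ_{Δ′(c)} T` at every recorded plaquette ((70)–(71) p.273), a `ccol·X`-separated family `S` of level-`j` plaquettes
split into DEEP members (a box of plaquettes based in `Ω_j(r)` near the member carrying `¼p_j²`) and the others (a point outside `Ω_j(r)` within `a₀L^j`), the
collar chain's reach `Rr`, the separation margins `hρ`/`hρd`, the `Zterm` bound by the level counts and the level counts by the plaquettes (`cnt`), and the
BUDGET `4d²·(σ_i + κZ·Σ_{l=i}^{j−1} x_l·cnt_l) ≤ ¼(p_i² − p_j²)`.  Conclusion: `|S|·¼p_j² + Σ_{i<j} #P_i(r)·σ_i + Zterm ≤ β·Σ_q T q`.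
[cite: Balaban1985UV3, (5) p.256, (41) p.266 and (69)-(71) p.273] -/
theorem dilute_core (hL : 2 ≤ P.L) (hd : 2 ≤ P.d) (M₁ : ℕ) (Rcol : ℕ → ℕ) {j : ℕ} (hj : j ≤ P.m + P.K) (r : Hist P j)
    (hr : Hist.Admissible M₁ Rcol j r) (T : Plaq P 0 → ℝ) (hT : ∀ q, 0 ≤ T q) {β : ℝ} (hβ : 0 ≤ β)
    (Bl : (i : ℕ) → Plaq P i → Finset (Plaq P 0)) (hBl : ∀ i (c : Plaq P i) q, q ∈ Bl i c → q.src ∈ plaqCover c)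
    (p : ℕ → ℝ) (hSF : ∀ i (hi : i < j), ∀ c ∈ r ⟨i, hi⟩, p i ^ 2 / 4 ≤ β * ∑ q ∈ Bl i c, T q)
    (S : Finset (Plaq P j)) {ccol X : ℝ} (hsep : ∀ q ∈ S, ∀ q' ∈ S, q ≠ q' → ccol * X ≤ (Site.tdist q.src q'.src : ℝ))
    (Sd : Finset (Plaq P j)) (hSd : Sd ⊆ S) (Box : Plaq P j → Finset (Plaq P 0))
    (hBoxΩ : ∀ q ∈ Sd, ∀ q' ∈ Box q, q'.src ∈ Omega M₁ Rcol j r j)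
    {a₁ : ℝ} (hBoxNear : ∀ q ∈ Sd, ∀ q' ∈ Box q, (Site.tdist q'.src (toFine j q.src) : ℝ) ≤ a₁ * (P.L : ℝ) ^ j)
    (hBoxSF : ∀ q ∈ Sd, p j ^ 2 / 4 ≤ β * ∑ q' ∈ Box q, T q')
    {a₀ : ℝ} (hNonDeep : ∀ q ∈ S, q ∉ Sd → ∃ z, z ∉ Omega M₁ Rcol j r j ∧ (Site.tdist z (toFine j q.src) : ℝ) ≤ a₀ * (P.L : ℝ) ^ j)
    {Rr : ℝ} (hReach : ∀ z, z ∉ Omega M₁ Rcol j r j →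
      ∃ (i : ℕ) (hi : i < j) (c : Plaq P i), c ∈ r ⟨i, hi⟩ ∧ ∃ x ∈ plaqCover c, (Site.tdist x z : ℝ) ≤ Rr)
    (hρ : ∀ i, i < j → 2 * (Rr + a₀ * (P.L : ℝ) ^ j + (2 + P.d) * (P.L : ℝ) ^ i) +
      2 * (4 * (P.d * P.d) : ℕ) * ((4 + P.d) * (P.L : ℝ) ^ i) < (P.L : ℝ) ^ j * (ccol * X - 2 * P.d))
    (hρd : 2 * (a₁ * (P.L : ℝ) ^ j) < (P.L : ℝ) ^ j * (ccol * X - 2 * P.d))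
    (σ : ℕ → ℝ) (hσ : ∀ i, 0 ≤ σ i) {Zt κZ : ℝ} (hκZ : 0 ≤ κZ) (x cnt : ℕ → ℝ) (hx : ∀ i, 0 ≤ x i) (hcnt : ∀ i, 0 ≤ cnt i)
    (hZ : Zt ≤ κZ * ∑ i ∈ Finset.range j, x i * ((Finset.univ.filter fun y : Site P i => toFine i y ∉ Omega M₁ Rcol j r (i + 1)).card : ℝ))
    (hN : ∀ i, i < j → ((Finset.univ.filter fun y : Site P i => toFine i y ∉ Omega M₁ Rcol j r (i + 1)).card : ℝ) ≤
        (∑ l ∈ Finset.range (i + 1), ((if hl : l < j then r ⟨l, hl⟩ else (∅ : Finset (Plaq P l))).card : ℝ)) * cnt i)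
    (hbudget : ∀ i, i < j → ((4 * (P.d * P.d) : ℕ) : ℝ) * (σ i + κZ * ∑ l ∈ Finset.Ico i j, x l * cnt l) ≤ (p i ^ 2 - p j ^ 2) / 4) :
    (S.card : ℝ) * (p j ^ 2 / 4) + ∑ i ∈ Finset.range j, ((if hi : i < j then r ⟨i, hi⟩ else (∅ : Finset (Plaq P i))).card : ℝ) * σ i + Zt ≤
      β * ∑ q, T q := by
  -- notation
  set μ : ℕ := 4 * (P.d * P.d) with hμdef
  have hμpos : 0 < μ := by rw [hμdef]; positivity
  have hμR : (0 : ℝ) < (μ : ℝ) := by exact_mod_cast hμpos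
  set Pl : (i : ℕ) → Finset (Plaq P i) := fun i => if hi : i < j then r ⟨i, hi⟩ else ∅ with hPldef
  have hPl : ∀ i (hi : i < j), Pl i = r ⟨i, hi⟩ := fun i hi => by simp [hPldef, hi]
  have hLpos : (0 : ℝ) < (P.L : ℝ) := by exact_mod_cast P.L_pos
  have hLj : (0 : ℝ) < (P.L : ℝ) ^ j := pow_pos hLpos j
  set ρf : ℝ := (P.L : ℝ) ^ j * (ccol * X - 2 * P.d) with hρf
  -- fine separation of the members
  have hfine : ∀ q ∈ S, ∀ q' ∈ S, q ≠ q' → ρf ≤ (Site.tdist (toFine j q.src) (toFine j q'.src) : ℝ) :=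
    fun q hq q' hq' hne => fine_separation hL hj (hsep q hq q' hq' hne)
  -- the per-level charge `T_l`
  set Tc : ℕ → ℝ := fun l => κZ * ∑ i ∈ Finset.Ico l j, x i * cnt i with hTc
  -- Step 1: `Zt ≤ Σ_l #P_l · T_l`
  have hZ1 : Zt ≤ ∑ l ∈ Finset.range j, ((Pl l).card : ℝ) * Tc l := by
    have h1 : κZ * ∑ i ∈ Finset.range j, x i * ((Finset.univ.filter fun y : Site P i => toFine i y ∉ Omega M₁ Rcol j r (i + 1)).card : ℝ) ≤
        κZ * ∑ i ∈ Finset.range j, x i * ((∑ l ∈ Finset.range (i + 1), ((Pl l).card : ℝ)) * cnt i) := by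
      refine mul_le_mul_of_nonneg_left (Finset.sum_le_sum fun i hi => ?_) hκZ
      exact mul_le_mul_of_nonneg_left (hN i (Finset.mem_range.mp hi)) (hx i)
    have h2 : ∑ i ∈ Finset.range j, x i * ((∑ l ∈ Finset.range (i + 1), ((Pl l).card : ℝ)) * cnt i) =
        ∑ l ∈ Finset.range j, ((Pl l).card : ℝ) * ∑ i ∈ Finset.Ico l j, x i * cnt i := by
      have : ∑ i ∈ Finset.range j, x i * ((∑ l ∈ Finset.range (i + 1), ((Pl l).card : ℝ)) * cnt i) =
          ∑ i ∈ Finset.range j, ∑ l ∈ Finset.range (i + 1), ((Pl l).card : ℝ) * (x i * cnt i) := by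
        refine Finset.sum_congr rfl fun i _ => ?_
        rw [Finset.sum_mul, Finset.mul_sum]
        refine Finset.sum_congr rfl fun l _ => ?_
        ring
      rw [this, Finset.sum_comm' (s' := fun l => Finset.Ico l j) (t' := Finset.range j)]
      · refine Finset.sum_congr rfl fun l _ => ?_
        rw [Finset.mul_sum]
      · intro i l
        simp only [Finset.mem_range, Finset.mem_Ico]
        omega
    calc Zt ≤ _ := hZ
      _ ≤ _ := h1
      _ = κZ * ∑ l ∈ Finset.range j, ((Pl l).card : ℝ) * ∑ i ∈ Finset.Ico l j, x i * cnt i := by rw [h2]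
      _ = ∑ l ∈ Finset.range j, ((Pl l).card : ℝ) * Tc l := by
          rw [Finset.mul_sum]; refine Finset.sum_congr rfl fun l _ => ?_; rw [hTc]; ring
  -- Step 2: the graphs and the lower bound on the action
  let G : (i : ℕ) → SimpleGraph (Plaq P i) := fun i =>
    { Adj := fun c c' => c ≠ c' ∧ c ∈ Pl i ∧ c' ∈ Pl i ∧
        (Site.tdist (toFine i c.src) (toFine i c'.src) : ℝ) ≤ (4 + P.d) * (P.L : ℝ) ^ i
      symm := ⟨fun c c' h => ⟨fun heq => h.1 heq.symm, h.2.2.1, h.2.1, by rw [tdist_comm]; exact h.2.2.2⟩⟩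
      loopless := ⟨fun c h => h.1 rfl⟩ }
  have hGadj : ∀ i (c c' : Plaq P i), (G i).Adj c c' ↔ c ≠ c' ∧ c ∈ Pl i ∧ c' ∈ Pl i ∧
      (Site.tdist (toFine i c.src) (toFine i c'.src) : ℝ) ≤ (4 + P.d) * (P.L : ℝ) ^ i := fun i c c' => Iff.rfl
  have hBoxDisj : (Sd : Set (Plaq P j)).PairwiseDisjoint Box := by
    intro q hq q' hq' hne
    rw [Function.onFun, Finset.disjoint_left]
    intro b hb hb'
    have h1 := hBoxNear q hq b hb
    have h2 := hBoxNear q' hq' b hb'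
    have h3 := hfine q (hSd hq) q' (hSd hq') hne
    have htri : (Site.tdist (toFine j q.src) (toFine j q'.src) : ℝ) ≤ Site.tdist b.src (toFine j q.src) + Site.tdist b.src (toFine j q'.src) := by
      have := tdist_triangle (toFine j q.src) b.src (toFine j q'.src)
      rw [tdist_comm (toFine j q.src) b.src] at this
      exact_mod_cast this
    linarith
  have hparts := parts_le_total M₁ Rcol hj r hr Bl hBl G
    (fun i hij c hc c' hc' hne hdist => (hGadj i c c').mpr ⟨hne, (hPl i hij).symm ▸ hc, (hPl i hij).symm ▸ hc', hdist⟩)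
    Sd Box hBoxΩ hBoxDisj T hT
  -- rewrite the cluster part over plain levels
  set clu : ℕ → ℝ := fun i => ∑ Γ ∈ (Pl i).image (G i).connectedComponentMk,
      ∑ q ∈ ((Pl i).filter fun c => (G i).connectedComponentMk c = Γ).biUnion (Bl i), T q with hclu
  have hparts' : ∑ b ∈ Sd, ∑ q ∈ Box b, T q + ∑ i ∈ Finset.range j, clu i ≤ ∑ q, T q := by
    have heq : ∑ i ∈ (Finset.range j).attach,
        ∑ Γ ∈ (r ⟨i.1, Finset.mem_range.mp i.2⟩).image (G i.1).connectedComponentMk,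
          ∑ q ∈ ((r ⟨i.1, Finset.mem_range.mp i.2⟩).filter fun c => (G i.1).connectedComponentMk c = Γ).biUnion (Bl i.1), T q =
        ∑ i ∈ Finset.range j, clu i := by
      rw [← Finset.sum_attach (Finset.range j) clu]
      refine Finset.sum_congr rfl fun i _ => ?_
      simp only [hclu]
      rw [hPl i.1 (Finset.mem_range.mp i.2)]
    rw [← heq]; exact hparts
  -- per deep member and per cluster
  have hdeepLB : (Sd.card : ℝ) * (p j ^ 2 / 4) ≤ β * ∑ b ∈ Sd, ∑ q ∈ Box b, T q := by
    rw [Finset.mul_sum]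
    calc (Sd.card : ℝ) * (p j ^ 2 / 4) = ∑ _b ∈ Sd, p j ^ 2 / 4 := by rw [Finset.sum_const, nsmul_eq_mul]
      _ ≤ ∑ b ∈ Sd, β * ∑ q ∈ Box b, T q := Finset.sum_le_sum hBoxSF
  set nΓ : (i : ℕ) → (G i).ConnectedComponent → ℝ := fun i Γ => (((Pl i).filter fun c => (G i).connectedComponentMk c = Γ).card : ℝ) with hnΓ
  have hcluLB : ∀ i, i < j → ∑ Γ ∈ (Pl i).image (G i).connectedComponentMk, max 1 (nΓ i Γ / μ) * (p i ^ 2 / 4) ≤ β * clu i := by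
    intro i hi
    rw [hclu, Finset.mul_sum]
    refine Finset.sum_le_sum fun Γ hΓ => ?_
    have hne : ((Pl i).filter fun c => (G i).connectedComponentMk c = Γ).Nonempty := by
      obtain ⟨c, hc, hcΓ⟩ := Finset.mem_image.mp hΓ
      exact ⟨c, Finset.mem_filter.mpr ⟨hc, hcΓ⟩⟩
    have := cluster_lower_bound (Bl i) (hBl i) T hT hβ _ hne
      (fun c hc => hSF i hi c ((hPl i hi) ▸ (Finset.mem_filter.mp hc).1))
    simpa [hnΓ, hμdef] using this
  -- Step 3: sources of the non-deep members, level by level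
  set Sn : Finset (Plaq P j) := S.filter fun q => q ∉ Sd with hSn
  have hcardS : (S.card : ℝ) = Sd.card + Sn.card := by
    have : S = Sd ∪ Sn := by
      ext q; simp only [Finset.mem_union, hSn, Finset.mem_filter]
      constructor
      · intro hq; by_cases h : q ∈ Sd; exact Or.inl h; exact Or.inr ⟨hq, h⟩
      · rintro (h | h); exact hSd h; exact h.1
    have hdisj : Disjoint Sd Sn := by
      rw [Finset.disjoint_left]; intro q hq hq'; exact (Finset.mem_filter.mp hq').2 hq
    rw [this, Finset.card_union_of_disjoint hdisj]; push_cast; ring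
  set R' : ℝ := Rr + a₀ * (P.L : ℝ) ^ j with hR'
  -- level-independent source data: a fine site and an orientation
  haveI : Nonempty {mn : Fin P.d × Fin P.d // mn.1 < mn.2} :=
    ⟨⟨(⟨0, by omega⟩, ⟨1, by omega⟩), by simp [Fin.lt_def]⟩⟩
  have key : ∀ q : Plaq P j, ∃ (i : ℕ) (sf : Site P 0) (mn : {mn : Fin P.d × Fin P.d // mn.1 < mn.2}),
      q ∈ Sn → i < j ∧ (⟨coarsen i sf, mn.1.1, mn.1.2, mn.2⟩ : Plaq P i) ∈ Pl i ∧
        ∃ x' ∈ plaqCover (⟨coarsen i sf, mn.1.1, mn.1.2, mn.2⟩ : Plaq P i), (Site.tdist x' (toFine j q.src) : ℝ) ≤ R' := by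
    intro q
    by_cases hq : q ∈ Sn
    · obtain ⟨hqS, hqd⟩ := Finset.mem_filter.mp hq
      obtain ⟨z, hz, hzd⟩ := hNonDeep q hqS hqd
      obtain ⟨i, hi, c, hc, x', hx', hxd⟩ := hReach z hz
      refine ⟨i, toFine i c.src, ⟨(c.μ, c.ν), c.hμν⟩, fun _ => ⟨hi, ?_, x', ?_, ?_⟩⟩
      · have hc' : (⟨coarsen i (toFine i c.src), c.μ, c.ν, c.hμν⟩ : Plaq P i) = c := by
          rw [coarsen_toFine i (by omega)]
        rw [hc', hPl i hi]; exact hc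
      · have hc' : (⟨coarsen i (toFine i c.src), c.μ, c.ν, c.hμν⟩ : Plaq P i) = c := by
          rw [coarsen_toFine i (by omega)]
        rw [hc']; exact hx'
      · have htri : (Site.tdist x' (toFine j q.src) : ℝ) ≤ Site.tdist x' z + Site.tdist z (toFine j q.src) := by
          exact_mod_cast tdist_triangle x' z (toFine j q.src)
        rw [hR']; linarith
    · exact ⟨0, Classical.arbitrary _, Classical.arbitrary _, fun h => absurd h hq⟩
  choose lvl sf mn hkey using key
  -- the source plaquette at level `i`
  set ctr : (i : ℕ) → Plaq P j → Plaq P i := fun i q => ⟨coarsen i (sf q), (mn q).1.1, (mn q).1.2, (mn q).2⟩ with hctr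
  have hlvl : ∀ q ∈ Sn, lvl q < j := fun q hq => (hkey q hq).1
  have hctrP : ∀ q ∈ Sn, ctr (lvl q) q ∈ Pl (lvl q) := fun q hq => (hkey q hq).2.1
  have hctrR : ∀ q ∈ Sn, ∀ i, lvl q = i → (Site.tdist (toFine j q.src) (toFine i (ctr i q).src) : ℝ) ≤ R' + (2 + P.d) * (P.L : ℝ) ^ i := by
    intro q hq i hiq
    subst hiq
    obtain ⟨x', hx', hxd⟩ := (hkey q hq).2.2
    have h1 := HistoryTailZCount.tdist_le_of_mem_plaqCover_toFine (l := lvl q) (by have := hlvl q hq; omega) hx'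
    have htri : (Site.tdist (toFine j q.src) (toFine (lvl q) (ctr (lvl q) q).src) : ℝ) ≤
        Site.tdist x' (toFine j q.src) + Site.tdist x' (toFine (lvl q) (ctr (lvl q) q).src) := by
      have := tdist_triangle (toFine j q.src) x' (toFine (lvl q) (ctr (lvl q) q).src)
      rw [tdist_comm (toFine j q.src) x'] at this
      exact_mod_cast this
    linarith
  -- members served per cluster ≤ max(1, n/μ)
  set Mi : ℕ → Finset (Plaq P j) := fun i => Sn.filter fun q => lvl q = i with hMi
  set mΓ : (i : ℕ) → (G i).ConnectedComponent → ℝ := fun i Γ =>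
    (((Mi i).filter fun q => (G i).connectedComponentMk (ctr i q) = Γ).card : ℝ) with hmΓ
  have hserve : ∀ i, i < j → ∀ Γ : (G i).ConnectedComponent, mΓ i Γ ≤ max 1 (nΓ i Γ / μ) := by
    intro i hi Γ
    have hiK : i ≤ P.m + P.K := by omega
    have hδ0 : (0 : ℝ) < (4 + P.d) * (P.L : ℝ) ^ i := by positivity
    have h := members_le_max (G := G i) (Pl i) (fun a b hab => ((hGadj i a b).mp hab).2.2.1) (Mi i) (ctr i)
      (fun q v => (Site.tdist (toFine j q.src) (toFine i v.src) : ℝ)) hδ0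
      (fun q a b hab => by
        have hd' := ((hGadj i a b).mp hab).2.2.2
        have := tdist_triangle (toFine j q.src) (toFine i a.src) (toFine i b.src)
        have h' : (Site.tdist (toFine j q.src) (toFine i b.src) : ℝ) ≤
            Site.tdist (toFine j q.src) (toFine i a.src) + Site.tdist (toFine i a.src) (toFine i b.src) := by exact_mod_cast this
        linarith)
      (R := R' + (2 + P.d) * (P.L : ℝ) ^ i)
      (fun q hq => hctrR q (Finset.mem_filter.mp hq).1 i (Finset.mem_filter.mp hq).2)
      (ρ := ρf)
      (fun q hq q' hq' hne v => by
        have h1 := hfine q (Finset.mem_filter.mp (Finset.mem_filter.mp hq).1).1 q'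
          (Finset.mem_filter.mp (Finset.mem_filter.mp hq').1).1 hne
        have := tdist_triangle (toFine j q.src) (toFine i v.src) (toFine j q'.src)
        rw [tdist_comm (toFine i v.src) (toFine j q'.src)] at this
        have h' : (Site.tdist (toFine j q.src) (toFine j q'.src) : ℝ) ≤
            Site.tdist (toFine j q.src) (toFine i v.src) + Site.tdist (toFine j q'.src) (toFine i v.src) := by exact_mod_cast this
        linarith)
      μ hμpos (by rw [hR']; linarith [hρ i hi]) Γ
    simpa [hmΓ, hnΓ] using h
  -- Step 4: counting identities
  have hSn_count : (Sn.card : ℝ) = ∑ i ∈ Finset.range j, ∑ Γ ∈ (Pl i).image (G i).connectedComponentMk, mΓ i Γ := by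
    have h1 : Sn.card = ∑ i ∈ Finset.range j, (Mi i).card := by
      rw [Finset.card_eq_sum_card_fiberwise (f := lvl) (t := Finset.range j) fun q hq => Finset.mem_range.mpr (hlvl q hq)]
    have h2 : ∀ i ∈ Finset.range j, (Mi i).card =
        ∑ Γ ∈ (Pl i).image (G i).connectedComponentMk, ((Mi i).filter fun q => (G i).connectedComponentMk (ctr i q) = Γ).card := by
      intro i _
      refine Finset.card_eq_sum_card_fiberwise fun q hq => ?_
      obtain ⟨hqSn, hqi⟩ := Finset.mem_filter.mp hq
      exact Finset.mem_image.mpr ⟨ctr i q, hqi ▸ hctrP q hqSn, rfl⟩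
    rw [h1]; push_cast
    refine Finset.sum_congr rfl fun i hi => ?_
    rw [h2 i hi]; push_cast; rfl
  have hPl_count : ∀ i, ((Pl i).card : ℝ) = ∑ Γ ∈ (Pl i).image (G i).connectedComponentMk, nΓ i Γ := by
    intro i
    rw [Finset.card_eq_sum_card_image ((G i).connectedComponentMk) (Pl i)]; push_cast; rfl
  -- Step 5: the final estimate
  have hΔ : ∀ i, i < j → σ i + Tc i ≤ (p i ^ 2 - p j ^ 2) / 4 / μ := by
    intro i hi
    rw [le_div_iff₀ hμR, mul_comm]
    exact hbudget i hi
  have hΔ0 : ∀ i, i < j → 0 ≤ (p i ^ 2 - p j ^ 2) / 4 := by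
    intro i hi
    have h1 := hbudget i hi
    have h2 : 0 ≤ σ i + κZ * ∑ l ∈ Finset.Ico i j, x l * cnt l :=
      add_nonneg (hσ i) (mul_nonneg hκZ (Finset.sum_nonneg fun l _ => mul_nonneg (hx l) (hcnt l)))
    nlinarith
  -- the left-hand side, level by level
  have hmain : (Sn.card : ℝ) * (p j ^ 2 / 4) + ∑ i ∈ Finset.range j, ((Pl i).card : ℝ) * (σ i + Tc i) ≤
      ∑ i ∈ Finset.range j, ∑ Γ ∈ (Pl i).image (G i).connectedComponentMk, max 1 (nΓ i Γ / μ) * (p i ^ 2 / 4) := by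
    rw [hSn_count, Finset.sum_mul, ← Finset.sum_add_distrib]
    refine Finset.sum_le_sum fun i hi => ?_
    have hi' : i < j := Finset.mem_range.mp hi
    rw [hPl_count i, Finset.sum_mul, Finset.sum_mul, ← Finset.sum_add_distrib]
    refine Finset.sum_le_sum fun Γ _ => ?_
    have h1 : mΓ i Γ ≤ max 1 (nΓ i Γ / μ) := hserve i hi' Γ
    have h2 : nΓ i Γ * (σ i + Tc i) ≤ max 1 (nΓ i Γ / μ) * ((p i ^ 2 - p j ^ 2) / 4) := by
      have hn0 : 0 ≤ nΓ i Γ := by rw [hnΓ]; exact Nat.cast_nonneg _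
      calc nΓ i Γ * (σ i + Tc i) ≤ nΓ i Γ * ((p i ^ 2 - p j ^ 2) / 4 / μ) := mul_le_mul_of_nonneg_left (hΔ i hi') hn0
        _ = (nΓ i Γ / μ) * ((p i ^ 2 - p j ^ 2) / 4) := by field_simp
        _ ≤ max 1 (nΓ i Γ / μ) * ((p i ^ 2 - p j ^ 2) / 4) := mul_le_mul_of_nonneg_right (le_max_right _ _) (hΔ0 i hi')
    have hpj : 0 ≤ p j ^ 2 / 4 := by positivity
    calc mΓ i Γ * (p j ^ 2 / 4) + nΓ i Γ * (σ i + Tc i)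
        ≤ max 1 (nΓ i Γ / μ) * (p j ^ 2 / 4) + max 1 (nΓ i Γ / μ) * ((p i ^ 2 - p j ^ 2) / 4) :=
          add_le_add (mul_le_mul_of_nonneg_right h1 hpj) h2
      _ = max 1 (nΓ i Γ / μ) * (p i ^ 2 / 4) := by ring
  -- assemble
  have hZσ : ∑ i ∈ Finset.range j, ((Pl i).card : ℝ) * σ i + Zt ≤ ∑ i ∈ Finset.range j, ((Pl i).card : ℝ) * (σ i + Tc i) := by
    have : ∑ i ∈ Finset.range j, ((Pl i).card : ℝ) * (σ i + Tc i) =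
        ∑ i ∈ Finset.range j, ((Pl i).card : ℝ) * σ i + ∑ i ∈ Finset.range j, ((Pl i).card : ℝ) * Tc i := by
      rw [← Finset.sum_add_distrib]; refine Finset.sum_congr rfl fun i _ => ?_; ring
    rw [this]; linarith [hZ1]
  have hRHS : (Sd.card : ℝ) * (p j ^ 2 / 4) +
      ∑ i ∈ Finset.range j, ∑ Γ ∈ (Pl i).image (G i).connectedComponentMk, max 1 (nΓ i Γ / μ) * (p i ^ 2 / 4) ≤ β * ∑ q, T q := by
    have h1 : ∑ i ∈ Finset.range j, ∑ Γ ∈ (Pl i).image (G i).connectedComponentMk, max 1 (nΓ i Γ / μ) * (p i ^ 2 / 4) ≤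
        ∑ i ∈ Finset.range j, β * clu i := Finset.sum_le_sum fun i hi => hcluLB i (Finset.mem_range.mp hi)
    have h1' : ∑ i ∈ Finset.range j, ∑ Γ ∈ (Pl i).image (G i).connectedComponentMk, max 1 (nΓ i Γ / μ) * (p i ^ 2 / 4) ≤
        β * ∑ i ∈ Finset.range j, clu i := by rw [Finset.mul_sum]; exact h1
    have h2 : β * (∑ b ∈ Sd, ∑ q ∈ Box b, T q + ∑ i ∈ Finset.range j, clu i) ≤ β * ∑ q, T q := mul_le_mul_of_nonneg_left hparts' hβ
    rw [mul_add] at h2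
    linarith [hdeepLB]
  calc (S.card : ℝ) * (p j ^ 2 / 4) + ∑ i ∈ Finset.range j, ((Pl i).card : ℝ) * σ i + Zt
      = (Sd.card : ℝ) * (p j ^ 2 / 4) + ((Sn.card : ℝ) * (p j ^ 2 / 4) + (∑ i ∈ Finset.range j, ((Pl i).card : ℝ) * σ i + Zt)) := by
        rw [hcardS]; ring
    _ ≤ (Sd.card : ℝ) * (p j ^ 2 / 4) + ((Sn.card : ℝ) * (p j ^ 2 / 4) + ∑ i ∈ Finset.range j, ((Pl i).card : ℝ) * (σ i + Tc i)) := by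
        linarith [hZσ]
    _ ≤ (Sd.card : ℝ) * (p j ^ 2 / 4) +
          ∑ i ∈ Finset.range j, ∑ Γ ∈ (Pl i).image (G i).connectedComponentMk, max 1 (nΓ i Γ / μ) * (p i ^ 2 / 4) := by
        linarith [hmain]
    _ ≤ β * ∑ q, T q := hRHS

end Summit.QuantumFields.YangMills.Theorems.HistoryTailDiluteCore

end
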